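import Summits.QuantumFields.YangMills.Theorems.BalabanUVNodesN15KingModelFreeRGThm31Letters
import HarnessLib

/-!
# BalabanUVNodes ∕ N15 — THE KING-MODEL RUNG, FREE-FIELD EDITION (PART Τ-g₂, RATES FOR THEOREM 3.1): the large-field exponent beats the volume —
# `G_m ≤ Γ·(√(M₀L^m))^{3−d}`, `R_m² ≥ b₀²(√L)^{(m+1)(4−d)}`, hence `R_m²∕(2G_m) ≥ κ(√L)^m`, while `ln(2|T₁^{(k)}|) + p(ε_m)² ≤ A₀(m+1)^{N+1}`; so
# there is `J` with `2|T₁^{(k)}|e^{−R_m²∕(2G_m)} ≤ e^{−p(L^kε_K)²}` for all `m ≥ J` and all `k` — the remainder of (3.4) with `C = 0`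
# (Track A, DAG node N15 = NE2; FAN-OUT v1.1 §N15 s3 «KING-MODEL RUNG»; regen R453 (b))

HONEST FRAMING.  Count-neutral (cell `pub-ymgap`, seat `pub-ymgap-dag-n15-e` g19; `--supports stmt-QuantumFields-27366 --as helper` = K3⁸
`SpineGivenEndpointR13SepCoPHV`).  REAL ANALYSIS on the letters of parts Τ-e∕Τ-g₁ (no new object): King's (3.4) bounds the large-field contribution
by `exp[−p(L^kε_K)² + C|T|]`; for the free field the large-field region is `{∃y : |φ_k(y)| > R_m}`, `R_m = p(ε_{m+1})ε_{m+1}^{−(4−d)∕4}` ((3.2) at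
`λ := 1`), its Gaussian mass is `≤ 2|T₁^{(k)}|e^{−R_m²∕(2G_m)}` (part Τ-g₁), and THIS FILE shows the exponent wins: `R_m²∕(2G_m) ≥ κ(√L)^m` grows
geometrically in `m` (`ε_{m+1}^{−(4−d)∕2}` against a variance `≲ (√(M₀L^m))^{3−d}`, for `1 ≤ d ≤ 3`), whereas `ln(2|T₁^{(k)}|) + p(ε_m)²` grows
polynomially (`|T₁^{(k)}| = (M₀L^m)^d`, `p(ε) = b₀(1 + ln ε⁻¹)^p`); the threshold index `J` comes from Mathlib's
`tendsto_pow_const_div_const_pow_of_one_lt` (`n^k∕r^n → 0`, `r = √L > 1`).  Result ★ `exists_J_largeField`: `∃ J, ∀ m ≥ J, ∀ k,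
2|T₁^{(k)}|e^{−R_m²∕(2G_m)} ≤ e^{−p(ε_m)²}`.  HONEST SCOPE: `1 ≤ d ≤ 3` (King's `d = 2, 3` and `d = 1`; for `d ≥ 4` the (3.2) threshold has no power of
`ε` and the Gaussian tail does not beat `|T₁|` with these letters), `L ≥ 2`, `M₀ ≥ 1`, `a, m², b₀ > 0`, `p ≥ 0`; the remainder constant `C` of (3.4) is
`0` and the index `J` depends on all letters incl. `|T| = M₀^d` (King's `J` is *"some fixed integer"*).  NOT Bałaban's objects; NOT a node discharge;
nothing continuum-YM ∕ ℝ⁴ ∕ OS ∕ mass-gap ∕ Clay.  0 `sorry`, 0 `def`; standard axioms.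
Locators: [King1986] (3.1)–(3.2) p.655, Thm 3.1 (3.4) p.655 («for some fixed integer J, for all K ≥ J, and all k ≤ K − J»), (4.35) p.674.
-/

noncomputable section

namespace Summit.QuantumFields.YangMills.BalabanUVNodes.N15KingModelRung.FreeField

open Real Finset Matrix MeasureTheory Filter Topology
open Literature.MathematicalPhysics.QuantumFieldTheory.Balaban1983to89 (B2.pFn)
open Literature.MathematicalPhysics.QuantumFieldTheory.Balaban1983to89.B5Prop11Plancherel (Tor)
open Literature.MathematicalPhysics.QuantumFieldTheory.King1986 (cDelta cDelta_pos)
open Literature.MathematicalPhysics.QuantumFieldTheory.King1986.ContinuumLimit (eps eps_pos eps_le_one)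

variable {d : ℕ}

/-! ## §1 The variance letter is `≤ Γ·(√(M₀L^m))^{3−d}` -/

section Rates

variable (L : ℕ) [NeZero L] (M₀ : ℕ) [NeZero M₀]

/-- **The variance constant** `Γ = (a(1−L⁻²))⁻¹ + (m²)⁻¹ + (c(a,L)⁻¹ + π²∕4)·d·3^{d−1}∕π²`. [folklore] -/
theorem greenLetter_le (hd1 : 1 ≤ d) (hd3 : d ≤ 3) {a msq : ℝ} (ha : 0 < a) (hL : 2 ≤ L) (hmsq : 0 < msq) (hM₀ : 1 ≤ M₀) (m : ℕ) :
    greenLetter a L (unitMassSq msq L m) d (M₀ * L ^ m)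
      ≤ ((a * (1 - ((L : ℝ) ^ 2)⁻¹))⁻¹ + msq⁻¹ + ((cDelta (a * (1 - ((L : ℝ) ^ 2)⁻¹))⁻¹ d)⁻¹ + π ^ 2 / 4) * (d * 3 ^ (d - 1) / π ^ 2))
        * Real.sqrt ((M₀ * L ^ m : ℕ) : ℝ) ^ (3 - d) := by
  have hL0 : 0 < L := by omega
  have hamin : 0 < a * (1 - ((L : ℝ) ^ 2)⁻¹) := mul_pos ha (one_sub_invSq_pos hL)
  have hc : 0 < cDelta (a * (1 - ((L : ℝ) ^ 2)⁻¹))⁻¹ d := cDelta_pos (inv_pos.mpr hamin).le d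
  set Ms : ℝ := ((M₀ * L ^ m : ℕ) : ℝ) with hMs
  have hMs1 : (1 : ℝ) ≤ Ms := by
    rw [hMs]; exact_mod_cast Nat.one_le_iff_ne_zero.mpr (NeZero.ne (M₀ * L ^ m))
  have hMs0 : 0 < Ms := by linarith
  set s : ℝ := Real.sqrt Ms with hs
  have hs1 : 1 ≤ s := by rw [hs, Real.le_sqrt (by norm_num) hMs0.le]; simpa using hMs1
  have hs0 : 0 < s := by linarith
  have hss : s ^ 2 = Ms := by rw [hs, Real.sq_sqrt hMs0.le]
  obtain ⟨e, he⟩ : ∃ e, d + e = 3 := ⟨3 - d, by omega⟩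
  have he' : 3 - d = e := by omega
  have hde : d - 1 + 4 = e + 2 * d := by omega
  -- the three terms, each ≤ coefficient · s^e
  have hMsd : (Ms ^ d)⁻¹ = (s ^ (2 * d))⁻¹ := by rw [← hss, ← pow_mul]
  have hsd : 0 < s ^ (2 * d) := pow_pos hs0 _
  -- term 1: amin⁻¹ / Ms^d ≤ amin⁻¹ ≤ amin⁻¹ s^e
  have h1 : (Ms ^ d)⁻¹ * (a * (1 - ((L : ℝ) ^ 2)⁻¹))⁻¹ ≤ (a * (1 - ((L : ℝ) ^ 2)⁻¹))⁻¹ * s ^ e := by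
    have hMsdi : (Ms ^ d)⁻¹ ≤ 1 := inv_le_one_of_one_le₀ (one_le_pow₀ hMs1)
    have hse : 1 ≤ s ^ e := one_le_pow₀ hs1
    have hA : 0 ≤ (a * (1 - ((L : ℝ) ^ 2)⁻¹))⁻¹ := (inv_pos.mpr hamin).le
    calc (Ms ^ d)⁻¹ * (a * (1 - ((L : ℝ) ^ 2)⁻¹))⁻¹ ≤ 1 * (a * (1 - ((L : ℝ) ^ 2)⁻¹))⁻¹ := mul_le_mul_of_nonneg_right hMsdi hA
      _ = (a * (1 - ((L : ℝ) ^ 2)⁻¹))⁻¹ * 1 := by ring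
      _ ≤ _ := mul_le_mul_of_nonneg_left hse hA
  -- term 2: m2⁻¹ / Ms^d = msq⁻¹ L^{2m} / Ms^d ≤ msq⁻¹ s⁴ / s^{2d} ≤ msq⁻¹ s^e
  have hm2 : 0 < unitMassSq msq L m := by unfold unitMassSq; exact mul_pos hmsq (pow_pos (eps_pos hL0 m) 2)
  have h2 : (Ms ^ d)⁻¹ * (unitMassSq msq L m)⁻¹ ≤ msq⁻¹ * s ^ e := by
    have hL2m : ((L : ℝ) ^ m) ^ 2 ≤ Ms ^ 2 := by
      apply pow_le_pow_left₀ (by positivity)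
      rw [hMs]; push_cast
      have : (1 : ℝ) ≤ M₀ := by exact_mod_cast hM₀
      have hLm : (0 : ℝ) ≤ (L : ℝ) ^ m := by positivity
      nlinarith
    have hinv : (unitMassSq msq L m)⁻¹ = msq⁻¹ * ((L : ℝ) ^ m) ^ 2 := by
      unfold unitMassSq eps; rw [mul_inv, inv_pow, inv_inv]
    rw [hinv, hMsd]
    have hs4 : Ms ^ 2 = s ^ 4 := by rw [← hss]; ring
    -- s^4 ≤ s^e · s^{2d} (4 ≤ e + 2d since d ≥ 1)
    have hpow : s ^ 4 ≤ s ^ e * s ^ (2 * d) := by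
      rw [← pow_add]; exact pow_le_pow_right₀ hs1 (by omega)
    calc (s ^ (2 * d))⁻¹ * (msq⁻¹ * ((L : ℝ) ^ m) ^ 2) ≤ (s ^ (2 * d))⁻¹ * (msq⁻¹ * s ^ 4) := by
          rw [← hs4]; exact mul_le_mul_of_nonneg_left (mul_le_mul_of_nonneg_left hL2m (inv_pos.mpr hmsq).le) (by positivity)
      _ ≤ (s ^ (2 * d))⁻¹ * (msq⁻¹ * (s ^ e * s ^ (2 * d))) :=
          mul_le_mul_of_nonneg_left (mul_le_mul_of_nonneg_left hpow (inv_pos.mpr hmsq).le) (by positivity)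
      _ = msq⁻¹ * s ^ e := by field_simp
  -- term 3: exact evaluation (Ms/2π)²·2d·2·3^{d−1}s^{d−1}/Ms^d = (d 3^{d−1}/π²) s^e
  have h3 : (Ms ^ d)⁻¹ * (((cDelta (a * (1 - ((L : ℝ) ^ 2)⁻¹))⁻¹ d)⁻¹ + π ^ 2 / 4) * (Ms / (2 * π)) ^ 2 * (2 * d * (2 * 3 ^ (d - 1) * s ^ (d - 1))))
      = ((cDelta (a * (1 - ((L : ℝ) ^ 2)⁻¹))⁻¹ d)⁻¹ + π ^ 2 / 4) * (d * 3 ^ (d - 1) / π ^ 2) * s ^ e := by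
    rw [hMsd, ← hss]
    have hkey : (s ^ 2) ^ 2 * s ^ (d - 1) = s ^ e * s ^ (2 * d) := by
      rw [← pow_mul, ← pow_add, ← pow_add]; congr 1; omega
    have hs2d : s ^ (2 * d) ≠ 0 := hsd.ne'
    have step : (s ^ (2 * d))⁻¹ * (((cDelta (a * (1 - ((L : ℝ) ^ 2)⁻¹))⁻¹ d)⁻¹ + π ^ 2 / 4) * (s ^ 2 / (2 * π)) ^ 2
          * (2 * d * (2 * 3 ^ (d - 1) * s ^ (d - 1))))
        = ((cDelta (a * (1 - ((L : ℝ) ^ 2)⁻¹))⁻¹ d)⁻¹ + π ^ 2 / 4) * (d * 3 ^ (d - 1) / π ^ 2)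
          * ((s ^ 2) ^ 2 * s ^ (d - 1)) * (s ^ (2 * d))⁻¹ := by
      field_simp
    rw [step, hkey]
    calc ((cDelta (a * (1 - ((L : ℝ) ^ 2)⁻¹))⁻¹ d)⁻¹ + π ^ 2 / 4) * (d * 3 ^ (d - 1) / π ^ 2) * (s ^ e * s ^ (2 * d)) * (s ^ (2 * d))⁻¹
        = ((cDelta (a * (1 - ((L : ℝ) ^ 2)⁻¹))⁻¹ d)⁻¹ + π ^ 2 / 4) * (d * 3 ^ (d - 1) / π ^ 2) * s ^ e * (s ^ (2 * d) * (s ^ (2 * d))⁻¹) := by ring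
      _ = _ := by rw [mul_inv_cancel₀ hs2d, mul_one]
  unfold greenLetter
  rw [he', mul_add, mul_add]
  calc (Ms ^ d)⁻¹ * (a * (1 - ((L : ℝ) ^ 2)⁻¹))⁻¹ + (Ms ^ d)⁻¹ * (unitMassSq msq L m)⁻¹
        + (Ms ^ d)⁻¹ * (((cDelta (a * (1 - ((L : ℝ) ^ 2)⁻¹))⁻¹ d)⁻¹ + π ^ 2 / 4) * (Ms / (2 * π)) ^ 2 * (2 * d * (2 * 3 ^ (d - 1) * s ^ (d - 1))))
      ≤ (a * (1 - ((L : ℝ) ^ 2)⁻¹))⁻¹ * s ^ e + msq⁻¹ * s ^ e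
        + ((cDelta (a * (1 - ((L : ℝ) ^ 2)⁻¹))⁻¹ d)⁻¹ + π ^ 2 / 4) * (d * 3 ^ (d - 1) / π ^ 2) * s ^ e := by rw [h3]; linarith
    _ = _ := by ring

omit [NeZero L] in
/-- **The threshold letter from below**: `R_m² ≥ b₀²·(√L)^{(m+1)(4−d)}` (`p(ε) ≥ b₀`, `ε_{m+1}^{−(4−d)∕2} = (√L)^{(m+1)(4−d)}`), `d ≤ 4`.
[cite: King1986, (3.1)–(3.2) p.655] -/
theorem threshold_sq_ge (hd4 : d ≤ 4) (hL : 2 ≤ L) {b₀ p : ℝ} (hb : 0 ≤ b₀) (hp : 0 ≤ p) (m : ℕ) :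
    b₀ ^ 2 * Real.sqrt L ^ ((m + 1) * (4 - d)) ≤ kingFreeThreshold d b₀ p L m ^ 2 := by
  have hL0 : 0 < L := by omega
  have hLr : (0 : ℝ) < L := by exact_mod_cast hL0
  have hε1pos : 0 < eps L (m + 1) := eps_pos hL0 (m + 1)
  have hε1le : eps L (m + 1) ≤ 1 := eps_le_one (by omega) (m + 1)
  -- pFn ≥ b₀
  have hP : b₀ ≤ B2.pFn b₀ p (eps L (m + 1)) := by
    rw [Literature.MathematicalPhysics.QuantumFieldTheory.King1986.ContinuumLimit.pFn_eq]
    have hinv : 1 ≤ (eps L (m + 1))⁻¹ := one_le_inv_iff₀.mpr ⟨hε1pos, hε1le⟩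
    have h1 : 1 ≤ 1 + Real.log (eps L (m + 1))⁻¹ := by have := Real.log_nonneg hinv; linarith
    have h2 : 1 ≤ (1 + Real.log (eps L (m + 1))⁻¹) ^ p := Real.one_le_rpow h1 hp
    nlinarith
  -- ε₁^{−(4−d)/4} = (√L)^{(m+1)(4−d)/2}, and its square = (√L)^{(m+1)(4−d)}
  obtain ⟨e, he⟩ : ∃ e, d + e = 4 := ⟨4 - d, by omega⟩
  have he' : 4 - d = e := by omega
  have hpow : (eps L (m + 1) ^ (-((4 - (d : ℝ)) / 4))) ^ 2 = Real.sqrt L ^ ((m + 1) * e) := by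
    have hde : (4 : ℝ) - d = e := by
      have : ((d + e : ℕ) : ℝ) = 4 := by exact_mod_cast he
      push_cast at this; linarith
    rw [hde, ← Real.rpow_natCast _ 2, ← Real.rpow_mul hε1pos.le]
    unfold eps
    rw [Real.inv_rpow (by positivity), ← Real.rpow_neg (by positivity), ← Real.rpow_natCast (L : ℝ) (m + 1), ← Real.rpow_mul hLr.le,
      Real.sqrt_eq_rpow, ← Real.rpow_natCast, ← Real.rpow_mul hLr.le]
    congr 1
    push_cast
    ring
  have hR0 : 0 ≤ B2.pFn b₀ p (eps L (m + 1)) := hb.trans hP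
  unfold kingFreeThreshold
  rw [mul_pow, he', ← hpow]
  exact mul_le_mul_of_nonneg_right (pow_le_pow_left₀ hb hP 2) (sq_nonneg _)

/-! ## §2 The polynomial side: `ln(2|T₁^{(k)}|) + p(ε_m)² ≤ A₀·(m+1)^{N+1}` -/

omit [NeZero L] [NeZero M₀] in
/-- **The volume-and-`p(ε)` letter**: with `N = ⌈2p⌉`, `A₀ = ln 2 + d(M₀ + L) + b₀²(1 + ln L)^{2p}`, for every `m`:
`ln 2 + d·ln(M₀L^m) + p(ε_m)² ≤ A₀·(m+1)^{N+1}`. [cite: King1986, (3.1) p.655] -/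
theorem polySide_le (hL : 2 ≤ L) (hM₀ : 1 ≤ M₀) {b₀ p : ℝ} (hp : 0 ≤ p) (m : ℕ) :
    Real.log 2 + d * Real.log ((M₀ * L ^ m : ℕ) : ℝ) + B2.pFn b₀ p (eps L m) ^ 2
      ≤ (Real.log 2 + d * ((M₀ : ℝ) + L) + b₀ ^ 2 * (1 + Real.log L) ^ (2 * p)) * ((m : ℝ) + 1) ^ (⌈2 * p⌉₊ + 1) := by
  have hL0 : 0 < L := by omega
  have hLr : (1 : ℝ) < L := by exact_mod_cast hL
  have hM₀r : (1 : ℝ) ≤ M₀ := by exact_mod_cast hM₀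
  have hm1 : (1 : ℝ) ≤ (m : ℝ) + 1 := by have : (0 : ℝ) ≤ m := Nat.cast_nonneg m; linarith
  set N : ℕ := ⌈2 * p⌉₊ with hN
  have hT : ∀ j : ℕ, j ≤ N + 1 → ((m : ℝ) + 1) ^ j ≤ ((m : ℝ) + 1) ^ (N + 1) := fun j hj => pow_le_pow_right₀ hm1 hj
  have hbig : (1 : ℝ) ≤ ((m : ℝ) + 1) ^ (N + 1) := one_le_pow₀ hm1
  have hlogL : 0 ≤ Real.log L := Real.log_nonneg hLr.le
  have hlogL' : Real.log L ≤ L := (Real.log_le_sub_one_of_pos (by linarith)).trans (by linarith)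
  -- piece 1: log 2
  have p1 : Real.log 2 ≤ Real.log 2 * ((m : ℝ) + 1) ^ (N + 1) := by
    have := Real.log_nonneg (show (1:ℝ) ≤ 2 by norm_num); nlinarith
  -- piece 2: d log(M₀ L^m) = d (log M₀ + m log L) ≤ d (M₀ + L)(m+1) ≤ d(M₀+L)(m+1)^{N+1}
  have p2 : (d : ℝ) * Real.log ((M₀ * L ^ m : ℕ) : ℝ) ≤ d * ((M₀ : ℝ) + L) * ((m : ℝ) + 1) ^ (N + 1) := by
    have hlog : Real.log ((M₀ * L ^ m : ℕ) : ℝ) = Real.log M₀ + m * Real.log L := by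
      push_cast
      rw [Real.log_mul (by positivity) (by positivity), Real.log_pow]
    rw [hlog]
    have hlogM : Real.log M₀ ≤ M₀ := (Real.log_le_sub_one_of_pos (by linarith)).trans (by linarith)
    have hm0 : (0 : ℝ) ≤ m := Nat.cast_nonneg m
    have hstep : Real.log M₀ + m * Real.log L ≤ ((M₀ : ℝ) + L) * ((m : ℝ) + 1) := by nlinarith
    have hd0 : (0 : ℝ) ≤ d := Nat.cast_nonneg d
    have h1' : ((M₀ : ℝ) + L) * ((m : ℝ) + 1) ≤ ((M₀ : ℝ) + L) * ((m : ℝ) + 1) ^ (N + 1) := by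
      have := hT 1 (by omega); rw [pow_one] at this
      exact mul_le_mul_of_nonneg_left this (by positivity)
    nlinarith
  -- piece 3: p(ε_m)² = b₀²(1 + m log L)^{2p} ≤ b₀²(1+log L)^{2p}(m+1)^{N}
  have p3 : B2.pFn b₀ p (eps L m) ^ 2 ≤ b₀ ^ 2 * (1 + Real.log L) ^ (2 * p) * ((m : ℝ) + 1) ^ (N + 1) := by
    rw [Literature.MathematicalPhysics.QuantumFieldTheory.King1986.ContinuumLimit.pFn_eq]
    have hlogε : Real.log (eps L m)⁻¹ = m * Real.log L := by
      unfold eps; rw [inv_inv, Real.log_pow]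
    rw [hlogε, mul_pow, ← Real.rpow_natCast ((1 + m * Real.log L) ^ p) 2, ← Real.rpow_mul (by positivity)]
    push_cast
    rw [show p * 2 = 2 * p by ring]
    have hbase : 1 + (m : ℝ) * Real.log L ≤ (1 + Real.log L) * ((m : ℝ) + 1) := by
      have hm0 : (0 : ℝ) ≤ m := Nat.cast_nonneg m; nlinarith
    have hA : (1 + (m : ℝ) * Real.log L) ^ (2 * p) ≤ ((1 + Real.log L) * ((m : ℝ) + 1)) ^ (2 * p) :=
      Real.rpow_le_rpow (by positivity) hbase (by positivity)
    rw [Real.mul_rpow (by positivity) (by positivity)] at hA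
    have hB : ((m : ℝ) + 1) ^ (2 * p) ≤ ((m : ℝ) + 1) ^ (N + 1) := by
      calc ((m : ℝ) + 1) ^ (2 * p) ≤ ((m : ℝ) + 1) ^ ((N + 1 : ℕ) : ℝ) :=
            Real.rpow_le_rpow_of_exponent_le hm1 (by rw [hN]; push_cast; linarith [Nat.le_ceil (2 * p)])
        _ = _ := Real.rpow_natCast _ _
    have hC : 0 ≤ (1 + Real.log L) ^ (2 * p) := by positivity
    calc b₀ ^ 2 * (1 + (m : ℝ) * Real.log L) ^ (2 * p) ≤ b₀ ^ 2 * ((1 + Real.log L) ^ (2 * p) * ((m : ℝ) + 1) ^ (2 * p)) :=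
          mul_le_mul_of_nonneg_left hA (sq_nonneg _)
      _ ≤ b₀ ^ 2 * ((1 + Real.log L) ^ (2 * p) * ((m : ℝ) + 1) ^ (N + 1)) :=
          mul_le_mul_of_nonneg_left (mul_le_mul_of_nonneg_left hB hC) (sq_nonneg _)
      _ = _ := by ring
  linarith

/-! ## §3 ★ The index `J`: the exponent beats the volume for `m ≥ J`, uniformly in `k` -/

/-- Exponent arithmetic: `(m+1)(4−d) = m(3−d) + (m + (4−d))` for `d ≤ 3`. [folklore] -/
theorem exp_arith (hd3 : d ≤ 3) (m : ℕ) : (m + 1) * (4 - d) = m * (3 - d) + (m + (4 - d)) := by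
  obtain ⟨e, he⟩ : ∃ e, d + e = 3 := ⟨3 - d, by omega⟩
  have h1 : 4 - d = e + 1 := by omega
  have h2 : 3 - d = e := by omega
  rw [h1, h2]; ring

/-- ★ **THE INDEX `J` OF THEOREM 3.1 FOR THE FREE FIELD**: for `1 ≤ d ≤ 3`, `L ≥ 2`, `M₀ ≥ 1`, `a, m², b₀ > 0`, `p ≥ 0` there is `J` such that for all
`m ≥ J` and ALL `k`: `2|T₁^{(k)}|·exp(−R_m²∕(2G_m)) ≤ exp(−p(ε_m)²)` — the Gaussian large-field mass is below King's remainder `exp[−p(L^kε_K)²]`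
(with `C = 0`). [cite: King1986, Thm 3.1 (3.4) p.655] -/
theorem exists_J_largeField (hd1 : 1 ≤ d) (hd3 : d ≤ 3) (hL : 2 ≤ L) (hM₀ : 1 ≤ M₀) {a msq b₀ p : ℝ} (ha : 0 < a) (hmsq : 0 < msq) (hb : 0 < b₀)
    (hp : 0 ≤ p) :
    ∃ J : ℕ, ∀ m : ℕ, J ≤ m →
      2 * (Fintype.card (Tor (cubeSide (d := d) M₀ L m)) : ℝ)
          * Real.exp (-(kingFreeThreshold d b₀ p L m ^ 2 / (2 * greenLetter a L (unitMassSq msq L m) d (M₀ * L ^ m))))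
        ≤ Real.exp (-(B2.pFn b₀ p (eps L m)) ^ 2) := by
  have hL0 : 0 < L := by omega
  have hLr : (1 : ℝ) < L := by exact_mod_cast hL
  have hM₀r : (1 : ℝ) ≤ M₀ := by exact_mod_cast hM₀
  have hamin : 0 < a * (1 - ((L : ℝ) ^ 2)⁻¹) := mul_pos ha (one_sub_invSq_pos hL)
  have hc : 0 < cDelta (a * (1 - ((L : ℝ) ^ 2)⁻¹))⁻¹ d := cDelta_pos (inv_pos.mpr hamin).le d
  have hd0 : (0 : ℝ) < d := by exact_mod_cast hd1
  -- the letters Γ, r = √L, κ, A₀, N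
  set Γ : ℝ := (a * (1 - ((L : ℝ) ^ 2)⁻¹))⁻¹ + msq⁻¹ + ((cDelta (a * (1 - ((L : ℝ) ^ 2)⁻¹))⁻¹ d)⁻¹ + π ^ 2 / 4) * (d * 3 ^ (d - 1) / π ^ 2)
    with hΓ
  have hΓ0 : 0 < Γ := by rw [hΓ]; positivity
  set r : ℝ := Real.sqrt L with hr
  have hr1 : 1 < r := by rw [hr, Real.lt_sqrt (by norm_num)]; simpa using hLr
  have hr0 : 0 < r := by linarith
  have hrr : r ^ 2 = L := by rw [hr, Real.sq_sqrt (by linarith)]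
  set κ : ℝ := b₀ ^ 2 * r ^ (4 - d) / (2 * (Γ * Real.sqrt M₀ ^ (3 - d))) with hκ
  have hsM : 0 < Real.sqrt (M₀ : ℝ) := Real.sqrt_pos.mpr (by linarith)
  have hκ0 : 0 < κ := by rw [hκ]; positivity
  set A₀ : ℝ := Real.log 2 + d * ((M₀ : ℝ) + L) + b₀ ^ 2 * (1 + Real.log L) ^ (2 * p) with hA₀
  have hA₀0 : 0 < A₀ := by
    rw [hA₀]; have := Real.log_pos (show (1:ℝ) < 2 by norm_num)
    have : 0 ≤ Real.log L := Real.log_nonneg hLr.le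
    positivity
  set N : ℕ := ⌈2 * p⌉₊ with hN
  -- the limit (m+1)^{N+1} / r^{m+1} → 0
  have hlim : Tendsto (fun m : ℕ => (((m + 1 : ℕ) : ℝ)) ^ (N + 1) / r ^ (m + 1)) atTop (𝓝 0) :=
    (tendsto_pow_const_div_const_pow_of_one_lt (N + 1) hr1).comp (tendsto_add_atTop_nat 1)
  have hev : ∀ᶠ m : ℕ in atTop, (((m + 1 : ℕ) : ℝ)) ^ (N + 1) / r ^ (m + 1) ≤ κ / (A₀ * r) :=
    (hlim.eventually (eventually_le_nhds (by positivity))).mono fun m hm => hm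
  obtain ⟨J, hJ⟩ := eventually_atTop.mp hev
  refine ⟨J, fun m hm => ?_⟩
  have hJm := hJ m hm
  -- unpack: A₀ (m+1)^{N+1} ≤ κ r^m
  have hrm : 0 < r ^ (m + 1) := pow_pos hr0 _
  have hpoly : A₀ * ((m : ℝ) + 1) ^ (N + 1) ≤ κ * r ^ m := by
    rw [div_le_div_iff₀ hrm (by positivity)] at hJm
    push_cast at hJm
    have e : κ * r ^ (m + 1) = (κ * r ^ m) * r := by ring
    rw [e] at hJm
    have : ((m : ℝ) + 1) ^ (N + 1) * (A₀ * r) = (A₀ * ((m : ℝ) + 1) ^ (N + 1)) * r := by ring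
    rw [this] at hJm
    exact le_of_mul_le_mul_right hJm hr0
  -- the exponent: R²/(2G) ≥ κ r^m
  have hG := greenLetter_le L M₀ hd1 hd3 ha hL hmsq hM₀ m
  have hm2 : 0 < unitMassSq msq L m := by unfold unitMassSq; exact mul_pos hmsq (pow_pos (eps_pos hL0 m) 2)
  have hGpos : 0 < greenLetter a L (unitMassSq msq L m) d (M₀ * L ^ m) := greenLetter_pos L ha hL hm2 hd1 (M₀ * L ^ m)
  have hR := threshold_sq_ge (d := d) L (by omega) hL hb.le hp m
  have hsqrtMs : Real.sqrt ((M₀ * L ^ m : ℕ) : ℝ) = Real.sqrt M₀ * r ^ m := by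
    push_cast
    rw [Real.sqrt_mul (by linarith)]
    congr 1
    have hLm : ((L : ℝ)) ^ m = (r ^ m) ^ 2 := by rw [← pow_mul, mul_comm, pow_mul, hrr]
    rw [hLm, Real.sqrt_sq (pow_nonneg hr0.le m)]
  have hGle : greenLetter a L (unitMassSq msq L m) d (M₀ * L ^ m) ≤ Γ * (Real.sqrt M₀ ^ (3 - d) * r ^ (m * (3 - d))) := by
    refine hG.trans (le_of_eq ?_)
    rw [hsqrtMs, mul_pow, ← pow_mul]
  have hexp : κ * r ^ m ≤ kingFreeThreshold d b₀ p L m ^ 2 / (2 * greenLetter a L (unitMassSq msq L m) d (M₀ * L ^ m)) := by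
    rw [le_div_iff₀ (by positivity)]
    -- κ r^m · 2G ≤ κ r^m · 2Γ √M₀^{3-d} r^{m(3-d)} = b₀² r^{4-d} r^m r^{m(3-d)} = b₀² r^{(m+1)(4-d)} ≤ R²
    calc κ * r ^ m * (2 * greenLetter a L (unitMassSq msq L m) d (M₀ * L ^ m))
        ≤ κ * r ^ m * (2 * (Γ * (Real.sqrt M₀ ^ (3 - d) * r ^ (m * (3 - d))))) := by
          have : 0 ≤ κ * r ^ m := by positivity
          nlinarith
      _ = b₀ ^ 2 * r ^ ((m + 1) * (4 - d)) := by
          rw [exp_arith hd3 m, pow_add, pow_add, hκ]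
          field_simp
      _ ≤ kingFreeThreshold d b₀ p L m ^ 2 := hR
  -- the polynomial side
  have hP := polySide_le (d := d) L M₀ hL hM₀ (b₀ := b₀) hp m
  have hcard : (Fintype.card (Tor (cubeSide (d := d) M₀ L m)) : ℝ) = ((M₀ * L ^ m : ℕ) : ℝ) ^ d := by
    rw [card_cube]; push_cast; ring
  have hMs0 : (0 : ℝ) < ((M₀ * L ^ m : ℕ) : ℝ) := by exact_mod_cast Nat.pos_of_ne_zero (NeZero.ne (M₀ * L ^ m))
  -- conclude: 2|T₁| e^{−R²/2G} = exp(log 2 + d log Ms − R²/2G) ≤ exp(−p²)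
  have hlhs : 2 * (Fintype.card (Tor (cubeSide (d := d) M₀ L m)) : ℝ)
        * Real.exp (-(kingFreeThreshold d b₀ p L m ^ 2 / (2 * greenLetter a L (unitMassSq msq L m) d (M₀ * L ^ m))))
      = Real.exp (Real.log 2 + d * Real.log ((M₀ * L ^ m : ℕ) : ℝ)
          - kingFreeThreshold d b₀ p L m ^ 2 / (2 * greenLetter a L (unitMassSq msq L m) d (M₀ * L ^ m))) := by
    rw [sub_eq_add_neg, Real.exp_add, Real.exp_add, Real.exp_log (by norm_num), ← Real.log_pow, Real.exp_log (pow_pos hMs0 d), hcard]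
  rw [hlhs, Real.exp_le_exp]
  linarith

end Rates

end Summit.QuantumFields.YangMills.BalabanUVNodes.N15KingModelRung.FreeField

end
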